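import Literature.Probability.LatticeModels.SixVertexSpectralRepresentation
import Literature.Probability.LatticeModels.SixVertexTransferMatrixPerron

/-!
# Six-vertex model: the up-shift operator `T(0)`, covariance of strip operators under row
# shifts, and the vertical-arrow operators `s_j(π/2)` (DKLM 2026, Part III §3, Lemmas 60–61)

H. Duminil-Copin, K. K. Kozlowski, P. Lammers, I. Manolescu, *Gaussian free field convergence of
the six-vertex model with `-1 ≤ Δ ≤ -1/2`*, arXiv:2603.06268 (2026) [DKLM2026SixVertexGFF]
(`paper:arxiv-2603.06268`, chunk p0043):

> For `j ∈ ℤ/Lℤ`, set `s_j(π/2) := 𝔬^{01}_{α_j}`, or equivalently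
> `e_{κ'}† s_j(π/2) e_κ := ∑_α α_j · 𝟙{ice rule for (κ,α,κ')} · c^{#c-vertices}`. […]
> For any `κ ∈ ℭ`, we let `κ↑ ∈ ℭ` denote the column configuration such that `(κ↑)_i = κ_{i-1}`.
> […] Define the *up-shift operator* `T(0) : Ω → Ω` by `e_{κ'}† T(0) e_κ := 𝟙{κ' = κ↑}`. […]
> `s_j(π/2) = T(0)^j s_0(π/2) T(0)^{-j}`.
> **Lemma 60** (The shift operator). […] `T(0)` is normal since `T(0)` commutes with
> `T(0)† = T(0)^{-1}`. Moreover, `T(0)` and `T(π/2)` commute thanks to shift-invariance of the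
> six-vertex model. […] Since `T(0)^L = Identity`, its eigenvalues are `L`-th roots of unity.
> **Lemma 61** (The edge measurement operator). The operator `S(π/2)` is anti-Hermitian, and
> `v_0† S(π/2) v_0 = 0`. *Proof.* […] `e_{κ'}† s_0 e_κ = … = -e_κ† s_0 e_{κ'}`. For the second
> property, […] `𝔼_{CYL_L}[the orientation of a fixed vertical edge] = 0`, where the expectation is
> zero since the measure is invariant under a global arrow flip.

Contents (isotropic weights `a = b`, column states over a finite additive group `G₂` of rows, in
the applications `G₂ = ℤ/Lℤ`; matrices indexed `(incoming, outgoing)` as in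
`SixVertexObservables.lean`, i.e. the transposes of the source's, so that the source's
`T(0)^j s_0 T(0)^{-j}` reads `T(0)^{-j} s_0 T(0)^{j}` here):

1. Generic strip operators: `obsMatrix_neg` and the **covariance of `𝔬_X` under symmetries of the
   weights**, `obsMatrix_mapObs` (`𝔬_{X ∘ (e,f)} = 𝔬_X ∘ (e × e)` as a `submatrix`).
2. The row shift `shiftRow κ = κ↑`, `shiftRowEquiv`, shift-invariance of the column weights and
   of the transfer matrix (`columnWeight_shiftRow`, `transferMatrix_shiftRow`), the balanced
   version `shiftBalEquiv : 𝔅 ≃ 𝔅`, and **the up-shift operator `upShiftMatrix = T(0)`**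
   (a permutation matrix): `upShiftMatrix_mul_transpose` (`T(0) T(0)ᵀ = 1`, orthogonality /
   normality), **`upShiftMatrix_mul_balancedTransferMatrix`** (`T(0)` commutes with `t_𝔅`,
   Lemma 60), `shiftBalEquiv_pow_apply` and **`upShiftMatrix_pow_card`** (`T(0)^{|G₂|} = 1`,
   Lemma 60: the eigenvalues are `L`-th roots of unity).
3. Row-shift covariance of strip operators: `shiftObs`, `balObsMatrix_shiftObs`
   (`𝔬_{X↑} = T(0) 𝔬_X T(0)ᵀ`).
4. **The vertical-arrow operators** `arrowObs j = α_j` (`±1` according to the vertical arrow in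
   row `j` of the column), `arrowMatrix c j = s_j(π/2)`: `arrowMatrix_sub_one`
   (`s_{j-1} = T(0) s_j T(0)ᵀ`), **`arrowMatrix_transpose`** (`s_jᵀ = -s_j`, Lemma 61, via the
   reflection symmetry Cor. 56 (4)), and **`cylinderObsExp_arrowObs`** (`𝔼_{CYL_L}[α_j] = 0` by
   the global arrow flip, Lemma 61), through the general `torusCondExp_eq_zero_of_flip_odd`.

## References

* H. Duminil-Copin, K. K. Kozlowski, P. Lammers, I. Manolescu, arXiv:2603.06268 (2026), Part III
  §3 (the operators `s_j(π/2)`, `T(0)`; Lemmas 60, 61). [DKLM2026SixVertexGFF]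
-/

noncomputable section

open Finset Matrix Filter Topology
open Literature.LinearAlgebra.Matrix

namespace Literature.Probability.LatticeModels.SixVertex

/-! ## 1. Generic strip operators: negation and covariance -/

section Generic

variable {S V R : Type*} [Fintype S] [DecidableEq S] [Fintype V]

omit [DecidableEq S] in
/-- `𝔬_{-X} = -𝔬_X`. [folklore] -/
theorem obsMatrix_neg [CommRing R] (r' : ℕ) (w : S → S → V → R)
    (X : S → (Fin (r' + 1) → S) → (Fin (r' + 1) → V) → R) :
    obsMatrix r' w (fun i κ α => -X i κ α) = -obsMatrix r' w X := by
  ext i j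
  simp only [obsMatrix, Matrix.neg_apply, Matrix.of_apply, neg_mul, Finset.sum_neg_distrib]

omit [Fintype S] [DecidableEq S] [Fintype V] in
/-- Mapping a glued strip through a map of states. [folklore] -/
theorem map_cons_snoc {r' : ℕ} (e : S → S) (i j : S) (κ' : Fin r' → S) (k : Fin (r' + 2)) :
    e ((Fin.cons i (Fin.snoc κ' j : Fin (r' + 1) → S) : Fin (r' + 2) → S) k) =
      (Fin.cons (e i) (Fin.snoc (fun m => e (κ' m)) (e j) : Fin (r' + 1) → S) : Fin (r' + 2) → S) k := by
  induction k using Fin.cases with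
  | zero => simp
  | succ k =>
    simp only [Fin.cons_succ]
    induction k using Fin.lastCases with
    | last => simp
    | cast m => simp

omit [Fintype S] [DecidableEq S] [Fintype V] in
/-- Mapping a `snoc` through a map of states. [folklore] -/
theorem map_snoc {r' : ℕ} (e : S → S) (j : S) (κ' : Fin r' → S) (k : Fin (r' + 1)) :
    e ((Fin.snoc κ' j : Fin (r' + 1) → S) k) = (Fin.snoc (fun m => e (κ' m)) (e j) : Fin (r' + 1) → S) k := by
  induction k using Fin.lastCases with
  | last => simp
  | cast m => simp

omit [DecidableEq S] in
/-- **Covariance of strip operators under symmetries of the weight**: if the column weight is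
invariant under a bijection `e` of the states together with a bijection `f` of the vertical
arrows, then the operator of the transported observable `X ∘ (e, f)` is the `submatrix` of
`𝔬_X` along `e`: `𝔬_{X∘(e,f)}(i, j) = 𝔬_X(e i, e j)`.
[cite: DKLM2026SixVertexGFF, Part III §3 ("`s_j = T(0)^j s_0 T(0)^{-j}`")] -/
theorem obsMatrix_mapObs [CommSemiring R] (r' : ℕ) (w : S → S → V → R) (e : S ≃ S) (f : V ≃ V)
    (hw : ∀ a b β, w (e a) (e b) (f β) = w a b β)
    (X : S → (Fin (r' + 1) → S) → (Fin (r' + 1) → V) → R) :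
    obsMatrix r' w (fun i κ α => X (e i) (fun k => e (κ k)) (fun k => f (α k))) =
      (obsMatrix r' w X).submatrix e e := by
  ext i j
  simp only [obsMatrix, Matrix.submatrix_apply, Matrix.of_apply]
  refine Fintype.sum_equiv (Equiv.piCongrRight fun _ : Fin r' => e) _ _ fun κ' => ?_
  refine Fintype.sum_equiv (Equiv.piCongrRight fun _ : Fin (r' + 1) => f) _ _ fun α' => ?_
  show _ = X (e i) (Fin.snoc (fun m => e (κ' m)) (e j)) (fun k => f (α' k)) *
      ∏ k : Fin (r' + 1),
        w ((Fin.cons (e i) (Fin.snoc (fun m => e (κ' m)) (e j) : Fin (r' + 1) → S) :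
            Fin (r' + 2) → S) k.castSucc)
          ((Fin.cons (e i) (Fin.snoc (fun m => e (κ' m)) (e j) : Fin (r' + 1) → S) :
            Fin (r' + 2) → S) k.succ) (f (α' k))
  have hX : (fun k => e ((Fin.snoc κ' j : Fin (r' + 1) → S) k)) =
      (Fin.snoc (fun m => e (κ' m)) (e j) : Fin (r' + 1) → S) :=
    funext fun k => map_snoc e j κ' k
  rw [hX]
  congr 1
  refine Finset.prod_congr rfl fun k _ => ?_
  rw [← hw, map_cons_snoc e i j κ' k.castSucc, map_cons_snoc e i j κ' k.succ]

end Generic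

/-! ## 2. The row shift and the up-shift operator `T(0)` -/

section Shift

variable {G₂ : Type*} [AddGroup G₂] [One G₂] [Fintype G₂] [DecidableEq G₂]

/-- **The row shift `κ↑`**: `(κ↑)_y = κ_{y-1}`. [cite: DKLM2026SixVertexGFF, Part III §3] -/
def shiftRow (κ : G₂ → Bool) : G₂ → Bool :=
  fun y => κ (y - 1)

omit [Fintype G₂] [DecidableEq G₂] in
/-- `(κ↑) y = κ (y - 1)`. [folklore] -/
@[simp] theorem shiftRow_apply (κ : G₂ → Bool) (y : G₂) : shiftRow κ y = κ (y - 1) := rfl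

/-- The row shift as a bijection of column configurations (inverse: the down shift).
[cite: DKLM2026SixVertexGFF, Part III §3] -/
def shiftRowEquiv : (G₂ → Bool) ≃ (G₂ → Bool) where
  toFun := shiftRow
  invFun κ y := κ (y + 1)
  left_inv κ := funext fun y => by simp [shiftRow]
  right_inv κ := funext fun y => by simp [shiftRow]

omit [Fintype G₂] [DecidableEq G₂] in
/-- `shiftRowEquiv κ = κ↑`. [folklore] -/
@[simp] theorem shiftRowEquiv_apply (κ : G₂ → Bool) : shiftRowEquiv κ = shiftRow κ := rfl

omit [DecidableEq G₂] in
/-- The row shift preserves balancedness. [folklore] -/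
theorem isBalancedCol_shiftRow_iff (κ : G₂ → Bool) : IsBalancedCol (shiftRow κ) ↔ IsBalancedCol κ := by
  unfold IsBalancedCol
  simp only [shiftRow_apply]
  rw [show (Finset.univ.filter fun y : G₂ => κ (y - 1) = true).card =
      (Finset.univ.filter fun y : G₂ => κ (Equiv.subRight (1 : G₂) y) = true).card from rfl,
    card_filter_apply_perm κ (Equiv.subRight (1 : G₂))]

/-- **The row shift on balanced column configurations** `𝔅 → 𝔅`. [cite: DKLM2026SixVertexGFF, Part III §3] -/
def shiftBalEquiv : {κ : G₂ → Bool // IsBalancedCol κ} ≃ {κ : G₂ → Bool // IsBalancedCol κ} :=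
  shiftRowEquiv.subtypeEquiv fun κ => (isBalancedCol_shiftRow_iff κ).symm

omit [DecidableEq G₂] in
/-- `(shiftBalEquiv κ).1 = κ↑`. [folklore] -/
@[simp] theorem shiftBalEquiv_apply_val (κ : {κ : G₂ → Bool // IsBalancedCol κ}) :
    (shiftBalEquiv κ).1 = shiftRow κ.1 := rfl

omit [DecidableEq G₂] in
/-- **Shift invariance of the column weights**: `w(κ↑, κ'↑, α↑) = w(κ, κ', α)`.
[cite: DKLM2026SixVertexGFF, Lemma 60 ("shift-invariance of the six-vertex model")] -/
theorem columnWeight_shiftRow (a b c : ℝ) (κ κ' α : G₂ → Bool) :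
    columnWeight a b c (shiftRow κ) (shiftRow κ') (shiftRow α) = columnWeight a b c κ κ' α := by
  unfold columnWeight
  exact Fintype.prod_equiv (Equiv.subRight (1 : G₂)) _ _ fun y => rfl

/-- **Shift invariance of the transfer matrix**: `t(κ↑, κ'↑) = t(κ, κ')`.
[cite: DKLM2026SixVertexGFF, Lemma 60] -/
theorem transferMatrix_shiftRow (a b c : ℝ) (κ κ' : G₂ → Bool) :
    transferMatrix a b c (shiftRow κ) (shiftRow κ') = transferMatrix a b c κ κ' := by
  simp only [transferMatrix, Matrix.of_apply]
  symm
  refine Fintype.sum_equiv shiftRowEquiv _ _ fun α => ?_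
  rw [shiftRowEquiv_apply, columnWeight_shiftRow]

/-- **The up-shift operator `T(0)`**: the permutation matrix `T(0)(κ, κ') = 𝟙{κ' = κ↑}` on
`ℓ²(𝔅)` (indexed `(incoming, outgoing)`). [cite: DKLM2026SixVertexGFF, Part III §3, eq. (def. of `T(0)`)] -/
def upShiftMatrix : Matrix {κ : G₂ → Bool // IsBalancedCol κ} {κ : G₂ → Bool // IsBalancedCol κ} ℝ :=
  (shiftBalEquiv (G₂ := G₂)).toPEquiv.toMatrix

omit [DecidableEq G₂] in
/-- `T(0)(κ, κ') = 𝟙{κ' = κ↑}`. [cite: DKLM2026SixVertexGFF, Part III §3] -/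
theorem upShiftMatrix_apply (κ κ' : {κ : G₂ → Bool // IsBalancedCol κ}) :
    upShiftMatrix κ κ' = if κ' = shiftBalEquiv κ then 1 else 0 := by
  unfold upShiftMatrix
  rw [PEquiv.toMatrix_apply, Equiv.toPEquiv_apply]
  simp only [Option.mem_def, Option.some.injEq]
  by_cases h : κ' = shiftBalEquiv κ
  · rw [if_pos h, if_pos h.symm]
  · rw [if_neg h, if_neg (Ne.symm h)]

omit [DecidableEq G₂] in
/-- The transpose of `T(0)` is the down-shift `T(0)^{-1}`. [cite: DKLM2026SixVertexGFF, Lemma 60] -/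
theorem upShiftMatrix_transpose :
    (upShiftMatrix (G₂ := G₂))ᵀ = (shiftBalEquiv (G₂ := G₂)).symm.toPEquiv.toMatrix := by
  unfold upShiftMatrix
  rw [Equiv.toPEquiv_symm, PEquiv.toMatrix_symm]

/-- **`T(0)` is orthogonal**: `T(0) T(0)ᵀ = 1` (so `T(0)` is normal, Lemma 60).
[cite: DKLM2026SixVertexGFF, Lemma 60] -/
theorem upShiftMatrix_mul_transpose :
    upShiftMatrix (G₂ := G₂) * (upShiftMatrix (G₂ := G₂))ᵀ = 1 := by
  rw [upShiftMatrix_transpose]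
  unfold upShiftMatrix
  rw [← PEquiv.toMatrix_trans, ← Equiv.toPEquiv_trans, Equiv.self_trans_symm, Equiv.toPEquiv_refl,
    PEquiv.toMatrix_refl]

/-- `T(0)ᵀ T(0) = 1`. [cite: DKLM2026SixVertexGFF, Lemma 60] -/
theorem upShiftMatrix_transpose_mul :
    (upShiftMatrix (G₂ := G₂))ᵀ * upShiftMatrix (G₂ := G₂) = 1 := by
  rw [upShiftMatrix_transpose]
  unfold upShiftMatrix
  rw [← PEquiv.toMatrix_trans, ← Equiv.toPEquiv_trans, Equiv.symm_trans_self, Equiv.toPEquiv_refl,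
    PEquiv.toMatrix_refl]

/-- Conjugation by `T(0)` is a `submatrix` along the shift: `T(0) M T(0)ᵀ = M ∘ (↑ × ↑)`.
[folklore] -/
theorem upShiftMatrix_mul_mul_transpose
    (M : Matrix {κ : G₂ → Bool // IsBalancedCol κ} {κ : G₂ → Bool // IsBalancedCol κ} ℝ) :
    upShiftMatrix * M * (upShiftMatrix (G₂ := G₂))ᵀ = M.submatrix shiftBalEquiv shiftBalEquiv := by
  rw [upShiftMatrix_transpose]
  unfold upShiftMatrix
  rw [PEquiv.toMatrix_toPEquiv_mul, PEquiv.mul_toMatrix_toPEquiv, Equiv.symm_symm]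
  rfl

/-- **Lemma 60: `T(0)` commutes with the transfer matrix** (shift invariance of the six-vertex
weights). [cite: DKLM2026SixVertexGFF, Lemma 60] -/
theorem upShiftMatrix_mul_balancedTransferMatrix (a b c : ℝ) :
    upShiftMatrix * balancedTransferMatrix (G₂ := G₂) a b c =
      balancedTransferMatrix (G₂ := G₂) a b c * upShiftMatrix := by
  unfold upShiftMatrix
  rw [PEquiv.toMatrix_toPEquiv_mul, PEquiv.mul_toMatrix_toPEquiv]
  ext κ κ'
  simp only [Matrix.submatrix_apply, id, balancedTransferMatrix, shiftBalEquiv_apply_val]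
  conv_rhs => rw [← transferMatrix_shiftRow a b c]
  congr 1
  have h : shiftBalEquiv (shiftBalEquiv.symm κ') = κ' := Equiv.apply_symm_apply _ _
  exact (congrArg Subtype.val h).symm

omit [DecidableEq G₂] in
/-- Iterating the shift: `(↑^m κ)_y = κ_{y - m•1}`. [folklore] -/
theorem shiftBalEquiv_pow_apply (m : ℕ) (κ : {κ : G₂ → Bool // IsBalancedCol κ}) (y : G₂) :
    ((shiftBalEquiv ^ m) κ).1 y = κ.1 (y - m • (1 : G₂)) := by
  induction m generalizing y with
  | zero => simp
  | succ m ih =>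
    rw [pow_succ', Equiv.Perm.mul_apply, shiftBalEquiv_apply_val, shiftRow_apply, ih]
    simp only [sub_eq_add_neg, succ_nsmul, neg_add_rev, add_assoc]

omit [DecidableEq G₂] in
/-- **`|G₂|` shifts are the identity** (`T(0)^L = Identity` for `G₂ = ℤ/Lℤ`).
[cite: DKLM2026SixVertexGFF, Lemma 60] -/
theorem shiftBalEquiv_pow_card : (shiftBalEquiv (G₂ := G₂)) ^ Fintype.card G₂ = 1 := by
  ext κ y
  rw [shiftBalEquiv_pow_apply, card_nsmul_eq_zero, sub_zero, Equiv.Perm.one_apply]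

/-- Powers of `T(0)` are the permutation matrices of the iterated shift. [folklore] -/
theorem upShiftMatrix_pow (m : ℕ) :
    upShiftMatrix (G₂ := G₂) ^ m = ((shiftBalEquiv (G₂ := G₂)) ^ m).toPEquiv.toMatrix := by
  induction m with
  | zero => rw [pow_zero, pow_zero, Equiv.Perm.one_def, Equiv.toPEquiv_refl, PEquiv.toMatrix_refl]
  | succ m ih =>
    rw [pow_succ, ih, pow_succ']
    unfold upShiftMatrix
    rw [← PEquiv.toMatrix_trans, ← Equiv.toPEquiv_trans]
    rfl

/-- **Lemma 60: `T(0)^{|G₂|} = 1`** — the eigenvalues of `T(0)` are `L`-th roots of unity.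
[cite: DKLM2026SixVertexGFF, Lemma 60] -/
theorem upShiftMatrix_pow_card : upShiftMatrix (G₂ := G₂) ^ Fintype.card G₂ = 1 := by
  rw [upShiftMatrix_pow, shiftBalEquiv_pow_card, Equiv.Perm.one_def, Equiv.toPEquiv_refl,
    PEquiv.toMatrix_refl]

/-! ## 3. Row-shift covariance of strip operators -/

/-- **The shifted strip observable `X↑`**: `X↑(i, κ, α) = X(i↑, κ↑, α↑)` (all column states and
all columns of vertical arrows shifted up by one row). [cite: DKLM2026SixVertexGFF, Part III §3] -/
def shiftObs {r' : ℕ}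
    (X : (G₂ → Bool) → (Fin (r' + 1) → G₂ → Bool) → (Fin (r' + 1) → G₂ → Bool) → ℝ) :
    (G₂ → Bool) → (Fin (r' + 1) → G₂ → Bool) → (Fin (r' + 1) → G₂ → Bool) → ℝ :=
  fun i κ α => X (shiftRow i) (fun k => shiftRow (κ k)) (fun k => shiftRow (α k))

/-- **Covariance under the row shift**: `𝔬_{X↑}(κ, κ') = 𝔬_X(κ↑, κ'↑)`, i.e.
`𝔬_{X↑} = T(0) 𝔬_X T(0)ᵀ` (`upShiftMatrix_mul_mul_transpose`).
[cite: DKLM2026SixVertexGFF, Part III §3 ("`s_j = T(0)^j s_0 T(0)^{-j}`")] -/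
theorem balObsMatrix_shiftObs (a b c : ℝ) (r' : ℕ)
    (X : (G₂ → Bool) → (Fin (r' + 1) → G₂ → Bool) → (Fin (r' + 1) → G₂ → Bool) → ℝ) :
    balObsMatrix a b c r' (shiftObs X) =
      (balObsMatrix a b c r' X).submatrix shiftBalEquiv shiftBalEquiv := by
  unfold balObsMatrix
  rw [← obsMatrix_mapObs r' (balColWeight a b c) shiftBalEquiv shiftRowEquiv
    (fun i j β => columnWeight_shiftRow a b c i.1 j.1 β)]
  rfl

/-- The same covariance as a conjugation: `𝔬_{X↑} = T(0) 𝔬_X T(0)ᵀ`.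
[cite: DKLM2026SixVertexGFF, Part III §3] -/
theorem balObsMatrix_shiftObs_eq_conj (a b c : ℝ) (r' : ℕ)
    (X : (G₂ → Bool) → (Fin (r' + 1) → G₂ → Bool) → (Fin (r' + 1) → G₂ → Bool) → ℝ) :
    balObsMatrix a b c r' (shiftObs X) =
      upShiftMatrix * balObsMatrix a b c r' X * (upShiftMatrix (G₂ := G₂))ᵀ := by
  rw [balObsMatrix_shiftObs, upShiftMatrix_mul_mul_transpose]

/-! ## 4. The vertical-arrow operators `s_j(π/2)` (Lemma 61) -/

/-- **The vertical-arrow observable `α_j`** on one column: `+1` if the vertical arrow in row `j`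
(the edge `(x, j) → (x, j+1)`) points north, `-1` otherwise. [cite: DKLM2026SixVertexGFF, Part III §3] -/
def arrowObs (j : G₂) : (G₂ → Bool) → (Fin 1 → G₂ → Bool) → (Fin 1 → G₂ → Bool) → ℝ :=
  fun _ _ α => if α 0 j = true then 1 else -1

/-- **`s_j(π/2) = 𝔬_{α_j}`**, the vertical-arrow operator on `ℓ²(𝔅)` (isotropic weights
`a = b = 1`). [cite: DKLM2026SixVertexGFF, Part III §3, eq. (def. of `s_j`)] -/
def arrowMatrix (c : ℝ) (j : G₂) :
    Matrix {κ : G₂ → Bool // IsBalancedCol κ} {κ : G₂ → Bool // IsBalancedCol κ} ℝ :=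
  balObsMatrix 1 1 c 0 (arrowObs j)

omit [Fintype G₂] [DecidableEq G₂] in
/-- Shifting the arrow observable moves the measured row: `(α_j)↑ = α_{j-1}`. [folklore] -/
theorem shiftObs_arrowObs (j : G₂) : shiftObs (arrowObs j) = arrowObs (j - 1) := rfl

/-- **`s_{j-1} = T(0) s_j T(0)ᵀ`** (the source's `s_j = T(0)^j s_0 T(0)^{-j}` in the
`(incoming, outgoing)` indexing). [cite: DKLM2026SixVertexGFF, Part III §3] -/
theorem arrowMatrix_sub_one (c : ℝ) (j : G₂) :
    arrowMatrix c (j - 1) = upShiftMatrix * arrowMatrix c j * (upShiftMatrix (G₂ := G₂))ᵀ := by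
  unfold arrowMatrix
  rw [← shiftObs_arrowObs, balObsMatrix_shiftObs_eq_conj]

omit [AddGroup G₂] [One G₂] [Fintype G₂] [DecidableEq G₂] in
/-- The reflected arrow observable is its negative (the reflection reverses vertical arrows,
Remark 24). [cite: DKLM2026SixVertexGFF, Lemma 61 (proof)] -/
theorem reflectObs_arrowObs (j : G₂) :
    reflectObs (arrowObs j) = fun i κ α => -arrowObs j i κ α := by
  funext i κ α
  simp only [reflectObs, arrowObs, Fin.rev_zero, Fin.last_zero]
  cases α 0 j <;> simp

/-- **Lemma 61: `s_j(π/2)` is anti-symmetric**, `s_jᵀ = -s_j` (reflection symmetry Cor. 56 (4)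
applied to `α_j`, whose reflection is `-α_j`). [cite: DKLM2026SixVertexGFF, Lemma 61] -/
theorem arrowMatrix_transpose (c : ℝ) (j : G₂) : (arrowMatrix c j)ᵀ = -arrowMatrix c j := by
  unfold arrowMatrix
  rw [← balObsMatrix_reflectObs, reflectObs_arrowObs]
  unfold balObsMatrix
  rw [← obsMatrix_neg]
  rfl

/-! ### `𝔼_{CYL_L}[α_j] = 0` by the global arrow flip (Lemma 61) -/

/-- **Flip-odd observables have zero conditional expectation**: the balanced torus measure is
invariant under reversing all arrows (`torusWeight_flip`, `isBalanced_flip_iff`), so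
`𝔼_{𝕋}[F | balanced] = 0` whenever `F ∘ flip = -F`. [cite: DKLM2026SixVertexGFF, §2.1 and Lemma 61 (proof)] -/
theorem torusCondExp_eq_zero_of_flip_odd {G₁ : Type*} [AddGroup G₁] [One G₁] [Fintype G₁]
    [DecidableEq G₁] (a b c : ℝ) (F : Config (G₁ × G₂) → ℝ)
    (hF : ∀ ω, F (fun w => (!(ω w).1, !(ω w).2)) = -F ω) : torusCondExp a b c F = 0 := by
  classical
  have hinv : Function.Involutive
      (fun (ω : Config (G₁ × G₂)) (w : G₁ × G₂) => (!(ω w).1, !(ω w).2)) := by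
    intro ω
    funext w
    simp
  let Φ : Config (G₁ × G₂) ≃ Config (G₁ × G₂) :=
    ⟨fun ω w => (!(ω w).1, !(ω w).2), fun ω w => (!(ω w).1, !(ω w).2),
      hinv.leftInverse, hinv.rightInverse⟩
  unfold torusCondExp
  set N : ℝ := ∑ ω : Config (G₁ × G₂), if IsBalanced ω then F ω * torusWeight a b c ω else 0 with hN
  have hneg : N = -N := by
    conv_lhs => rw [hN, ← Equiv.sum_comp Φ]
    rw [hN, ← Finset.sum_neg_distrib]
    refine Finset.sum_congr rfl fun ω _ => ?_
    have hΦω : (Φ ω : Config (G₁ × G₂)) = fun w => (!(ω w).1, !(ω w).2) := rfl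
    rw [hΦω, torusWeight_flip, hF]
    by_cases h : IsBalanced ω
    · rw [if_pos ((isBalanced_flip_iff ω).2 h), if_pos h, neg_mul]
    · rw [if_neg (fun h' => h ((isBalanced_flip_iff ω).1 h')), if_neg h, neg_zero]
  have hN0 : N = 0 := by linarith
  rw [hN0, zero_div]

omit [AddGroup G₂] [One G₂] [Fintype G₂] [DecidableEq G₂] in
/-- The torus reading of `α_j` is odd under the global arrow flip. [folklore] -/
theorem torusObs_arrowObs_flip {M : ℕ} (j : G₂) (ω : Config (ZMod M × G₂)) :
    torusObs 0 (arrowObs j) (fun w => (!(ω w).1, !(ω w).2)) = -torusObs 0 (arrowObs j) ω := by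
  obtain ⟨b, hb⟩ : ∃ b : Bool, (ω ((((0 : Fin 1) : ℕ) : ZMod M), j)).2 = b := ⟨_, rfl⟩
  simp only [torusObs, arrowObs, hb]
  cases b <;> simp

/-- `𝔼_{𝕋_{M,L}}[α_j | balanced] = 0` for every `M`. [cite: DKLM2026SixVertexGFF, Lemma 61 (proof)] -/
theorem torusObsExp_arrowObs (c : ℝ) (M : ℕ) (j : G₂) : torusObsExp c M 0 (arrowObs j) = 0 := by
  unfold torusObsExp
  split_ifs with hM
  · rfl
  · haveI : NeZero M := ⟨hM⟩
    exact torusCondExp_eq_zero_of_flip_odd 1 1 c _ (torusObs_arrowObs_flip j)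

/-- **Lemma 61: `𝔼_{CYL_L}[α_j] = 0`** — the cylinder expectation of the orientation of a fixed
vertical edge vanishes (`v_0† S(π/2) v_0 = 0`). [cite: DKLM2026SixVertexGFF, Lemma 61] -/
theorem cylinderObsExp_arrowObs (c : ℝ) (j : G₂) : cylinderObsExp c 0 (arrowObs j) = 0 := by
  unfold cylinderObsExp
  have h : (fun M : ℕ => torusObsExp c M 0 (arrowObs j)) = fun _ => 0 :=
    funext fun M => torusObsExp_arrowObs c M j
  rw [h]
  exact tendsto_const_nhds.limUnder_eq

end Shift

end Literature.Probability.LatticeModels.SixVertex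

end
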